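import Summits.CriticalPhenomena.SAWScalingLimit.Theses.SAWCompassLattice
import Summits.CriticalPhenomena.SAWScalingLimit.Theorems.SAWLoopFugacityFlowAvoidancePassageSandwich
import Literature.Probability.RandomPlanarGeometry.ConformalRestrictionProofs
import Literature.Probability.RandomPlanarGeometry.CritPercSLESimplePathHolds
import Literature.Probability.RandomPlanarGeometry.SimpleCurves
import Literature.Probability.RandomPlanarGeometry.CaratheodoryHalfPlaneProofs
import Literature.Probability.RandomPlanarGeometry.LocalMartingaleProofs

/-!
# Stub `stub_ybAvoidancePassage` (crux `CompassSLE`, stmt-CriticalPhenomena-6965, line registered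
# = birth, skeleton v2, item I3): the portmanteau sandwich for GM's `π/2` Yang–Baxter walk

The `π/2`-Yang–Baxter twin of the PROVED `δℤ²` item stmt-CriticalPhenomena-4984
(`Theorems.avoidancePassage_proof`, file `…SAWLoopFugacityFlowAvoidancePassage`): if `ν` is the
weak limit, along `s_n → 0⁺`, of Glazman–Manolescu's critical `π/2` Yang–Baxter laws
`ybLaw (fun _ => π/2) D.carrier (s n) 1 (a (s n)) (b (s n))` pushed to `CurveClass ℂ` by
`YBWalk.curve`, `μ` is a chordal SLE_(8/3) law of the Dobrushin domain `(D; a, b)`, and along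
`s_n` the lattice avoidance probabilities of EVERY hull subdomain `D''` (same marked points,
agreeing with `D` near them) converge to `μ(range ⊆ cl D'')`, then
`ν(range ⊆ cl D') = μ(range ⊆ cl D')` for every hull subdomain `D'`.

The argument is model-independent once the laws are pushed forward, so it is run for an abstract
sequence `P : ℕ → Measure (CurveClass ℂ)` of masses `0` or `1`
(`avoidancePassage_of_mass_zero_or_one`):

* `μ ≤ ν` on the closed event `F = rangeSubset (cl D')` (`CurveClass.isClosed_rangeSubset`):
  portmanteau `limsup Pₙ(F) ≤ ν(F)` (Mathlib, for the laws made probability measures — they are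
  probability measures eventually since their masses, `0` or `1`, converge to `ν(univ) = 1`) and
  `Pₙ(F) → μ(F)`.
* `ν ≤ μ`: exhaust `D ∖ cl D'` by compacts `K_k`; the SANDWICH LEMMA
  (`AvoidancePassage.exists_superdomain`) gives hull super-domains `D''_k = D ∖ T_k ⊇ D'`
  (`T_k` closed, off `cl D'`) missing `K_k`; with the open event `G_k = rangeSubset (T_kᶜ) ⊇ F`
  and `G_k ∩ {range ⊆ cl D} ⊆ F_k = rangeSubset (cl D''_k)`:
  `ν(F) ≤ ν(G_k) ≤ liminf Pₙ(G_k) ≤ lim (Pₙ(F_k) + Pₙ(range ⊄ cl D)) = μ(F_k)`, and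
  `μ(F_k) → μ(F)` because `μ`-a.e. curve has range in `D ∪ {a, b}` (Rohde–Schramm simplicity and
  Carathéodory, PROVED in the tree: `IsSLELaw.ae_simple` / `ae_endpoints` with
  `ae_isSimpleTrace_sleTrace_of_le_four_holds`, `CurveClass.measurableSet_simple_holds`,
  `JordanDomain.mapsTo_boundaryExtension_holds`), so a curve in infinitely many `F_k ∖ F` would
  have a point of `D ∖ cl D'`, eventually interior to `K_k`, inside `cl D''_k` — impossible.

The only lattice-specific input is `ybLaw_univ_eq_zero_or_one` (`ybLaw = Z⁻¹ • ybWeight` has total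
mass `0` or `1`). No named fact is assumed: the theorem is unconditional.
-/

noncomputable section

namespace Summit.CriticalPhenomena.SAWScalingLimit.Theorems.SAWCompassLatticeCompassSLE

open MeasureTheory Filter Topology Set Metric
open scoped NNReal ENNReal
open Literature.Probability.RandomPlanarGeometry
open Literature.Probability.RandomPlanarGeometry.SAW.YangBaxter
open Summit.CriticalPhenomena.SAWScalingLimit.Theses

/-! ### The lattice-specific input: total mass `0` or `1` -/

/-- The total mass of the Yang–Baxter SAW law `ybLaw = Z⁻¹ • ybWeight` is `0` (junk: `Z = 0` or
`Z = ∞`) or `1`. [folklore] -/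
theorem ybLaw_univ_eq_zero_or_one (Θ : ℤ → ℝ) (Ω : Set ℂ) (δ x : ℝ) (a b : MidEdge) :
    ybLaw Θ Ω δ x a b univ = 0 ∨ ybLaw Θ Ω δ x a b univ = 1 := by
  rw [ybLaw, Measure.smul_apply, smul_eq_mul]
  by_cases h0 : ybWeight Θ Ω δ x a b univ = 0
  · left
    rw [h0, mul_zero]
  by_cases ht : ybWeight Θ Ω δ x a b univ = ∞
  · left
    rw [ht, ENNReal.inv_top, zero_mul]
  · right
    exact ENNReal.inv_mul_cancel h0 ht

/-! ### The model-independent portmanteau sandwich -/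

/-- **The portmanteau sandwich, abstract form.** Let `P : ℕ → Measure (CurveClass ℂ)` be laws of
total mass `0` or `1` converging weakly (on bounded continuous test functions) to a probability
measure `ν`, let `μ` be a chordal SLE_(8/3) law of the Dobrushin domain `D`, and suppose that for
EVERY hull subdomain `D''` of `D` (same marked points, agreeing with `D` near them)
`Pₙ(range ⊆ cl D'') → μ(range ⊆ cl D'')`. Then `ν(range ⊆ cl D') = μ(range ⊆ cl D')` for every
hull subdomain `D'` (`≥` by portmanteau on the closed event, `≤` through the carved hull
super-domains of `AvoidancePassage.exists_superdomain`, open events, and the `μ`-a.e. regularity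
of SLE_(8/3); see the module docstring). [folklore] -/
theorem avoidancePassage_of_mass_zero_or_one (D : DobrushinDomain)
    (P : ℕ → Measure (CurveClass ℂ)) (ν μ : Measure (CurveClass ℂ)) (hν : IsProbabilityMeasure ν)
    (hmass01 : ∀ n, P n univ = 0 ∨ P n univ = 1)
    (hweakP : ∀ f : BoundedContinuousFunction (CurveClass ℂ) ℝ,
      Tendsto (fun n => ∫ x, f x ∂(P n)) atTop (𝓝 (∫ x, f x ∂ν)))
    (hμ : IsSLELaw ((8 : NNReal) / 3) D μ)
    (hconv : ∀ D' : DobrushinDomain, D'.carrier ⊆ D.carrier → D'.pt 0 = D.pt 0 →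
      D'.pt 1 = D.pt 1 →
      (∃ ε : ℝ, 0 < ε ∧ D'.carrier ∩ Metric.ball (D.pt 0) ε = D.carrier ∩ Metric.ball (D.pt 0) ε ∧
        D'.carrier ∩ Metric.ball (D.pt 1) ε = D.carrier ∩ Metric.ball (D.pt 1) ε) →
      Tendsto (fun n => P n (CurveClass.rangeSubset (closure D'.carrier))) atTop
        (𝓝 (μ (CurveClass.rangeSubset (closure D'.carrier)))))
    (D' : DobrushinDomain) (hD'sub : D'.carrier ⊆ D.carrier) (h0 : D'.pt 0 = D.pt 0)
    (h1 : D'.pt 1 = D.pt 1)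
    (hεD' : ∃ ε : ℝ, 0 < ε ∧
      D'.carrier ∩ Metric.ball (D.pt 0) ε = D.carrier ∩ Metric.ball (D.pt 0) ε ∧
        D'.carrier ∩ Metric.ball (D.pt 1) ε = D.carrier ∩ Metric.ball (D.pt 1) ε) :
    ν (CurveClass.rangeSubset (closure D'.carrier)) =
      μ (CurveClass.rangeSubset (closure D'.carrier)) := by
  classical
  haveI : Fact Literature.Probability.Process.isProjectiveLimit_preWienerMeasure :=
    ⟨isProjectiveLimit_preWienerMeasure_holds⟩
  haveI hμP : IsProbabilityMeasure μ := hμ.isProbabilityMeasure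
  -- notation
  set F : Set (CurveClass ℂ) := CurveClass.rangeSubset (closure D'.carrier) with hF
  have hFm : MeasurableSet F := CurveClass.measurableSet_rangeSubset isClosed_closure
  -- masses: `0` or `1`, eventually `1`
  have hmassT : Tendsto (fun n => (P n).real univ) atTop (𝓝 1) := by
    have h := hweakP (BoundedContinuousFunction.const (CurveClass ℂ) (1 : ℝ))
    simp only [BoundedContinuousFunction.const_apply, integral_const, smul_eq_mul, mul_one,
      probReal_univ] at h
    exact h
  have hevP : ∀ᶠ n in atTop, IsProbabilityMeasure (P n) := by
    have hev : ∀ᶠ n in atTop, (1 / 2 : ℝ) < (P n).real univ :=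
      hmassT.eventually (lt_mem_nhds (by norm_num))
    filter_upwards [hev] with n hn
    rcases hmass01 n with h | h
    · exfalso
      rw [measureReal_def, h, ENNReal.toReal_zero] at hn
      linarith
    · exact ⟨h⟩
  -- the laws as probability measures (eventually), and portmanteau
  let Q : ℕ → ProbabilityMeasure (CurveClass ℂ) := fun n =>
    if h : IsProbabilityMeasure (P n) then (⟨P n, h⟩ : ProbabilityMeasure (CurveClass ℂ))
    else (⟨ν, hν⟩ : ProbabilityMeasure (CurveClass ℂ))
  have hQP : ∀ᶠ n in atTop, (Q n : Measure (CurveClass ℂ)) = P n := by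
    filter_upwards [hevP] with n hn
    simp only [Q, dif_pos hn, ProbabilityMeasure.coe_mk]
  have hQlim : Tendsto Q atTop (𝓝 (⟨ν, hν⟩ : ProbabilityMeasure (CurveClass ℂ))) := by
    rw [ProbabilityMeasure.tendsto_iff_forall_integral_tendsto]
    intro f
    refine (hweakP f).congr' ?_
    filter_upwards [hQP] with n hn
    rw [hn]
  have hclosed : ∀ C : Set (CurveClass ℂ), IsClosed C →
      limsup (fun n => P n C) atTop ≤ ν C := by
    intro C hC
    have h := ProbabilityMeasure.limsup_measure_closed_le_of_tendsto hQlim hC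
    have heq : (fun n => P n C) =ᶠ[atTop] fun n => (Q n : Measure (CurveClass ℂ)) C :=
      hQP.mono fun n hn => by simp only [hn]
    rw [limsup_congr heq]
    exact h
  have hopen : ∀ G : Set (CurveClass ℂ), IsOpen G → ν G ≤ liminf (fun n => P n G) atTop := by
    intro G hG
    have h := ProbabilityMeasure.le_liminf_measure_open_of_tendsto hQlim hG
    have heq : (fun n => P n G) =ᶠ[atTop] fun n => (Q n : Measure (CurveClass ℂ)) G :=
      hQP.mono fun n hn => by simp only [hn]
    rw [liminf_congr heq]
    exact h
  -- `μ F ≤ ν F`: closed event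
  have hlimF : Tendsto (fun n => P n F) atTop (𝓝 (μ F)) := hconv D' hD'sub h0 h1 hεD'
  have hge : μ F ≤ ν F := by
    rw [← hlimF.limsup_eq]
    exact hclosed F (CurveClass.isClosed_rangeSubset isClosed_closure)
  -- `μ`-a.e. regularity of the SLE(8/3) law
  have hae : ∀ᵐ γ ∂μ, γ.range ⊆ closure D.carrier ∧
      γ.range ∩ frontier D.carrier ⊆ {D.pt 0, D.pt 1} := by
    have h83 : (0 : ℝ≥0) < 8 / 3 := by positivity
    have h83' : ((8 : ℝ≥0) / 3) ≤ 4 := by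
      rw [div_le_iff₀ (by norm_num : (0 : ℝ≥0) < 3)]
      norm_num
    filter_upwards [hμ.ae_endpoints JordanDomain.mapsTo_boundaryExtension_holds,
      hμ.ae_simple ae_isSimpleTrace_sleTrace_of_le_four_holds CurveClass.measurableSet_simple_holds
        h83 h83'] with γ hγ hγ'
    exact ⟨hγ.2.2, hγ'.2⟩
  -- the event `range ⊆ cl D` has full mass, in the limit of the laws too
  set S : Set (CurveClass ℂ) := CurveClass.rangeSubset (closure D.carrier) with hS
  have hSm : MeasurableSet S := CurveClass.measurableSet_rangeSubset isClosed_closure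
  have hμS : μ S = 1 := by
    rw [← prob_compl_eq_zero_iff hSm, measure_eq_zero_iff_ae_notMem]
    filter_upwards [hae] with γ hγ
    exact fun h => h hγ.1
  have hlimS : Tendsto (fun n => P n S) atTop (𝓝 1) := by
    have := hconv D Subset.rfl rfl rfl ⟨1, one_pos, rfl, rfl⟩
    rwa [hμS] at this
  have hlimSc : Tendsto (fun n => P n Sᶜ) atTop (𝓝 0) := by
    have h1 : (fun n => P n Sᶜ) =ᶠ[atTop] fun n => 1 - P n S := by
      filter_upwards [hevP] with n hn
      haveI := hn
      exact prob_compl_eq_one_sub hSm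
    rw [tendsto_congr' h1]
    have : Tendsto (fun n => (1 : ℝ≥0∞) - P n S) atTop (𝓝 (1 - 1)) :=
      ENNReal.Tendsto.sub tendsto_const_nhds hlimS (Or.inl ENNReal.one_ne_top)
    simpa using this
  -- exhaustion of `O = D ∖ cl D'` by compacts
  set O : Set ℂ := D.carrier \ closure D'.carrier with hO
  have hOo : IsOpen O := D.isOpen.sdiff isClosed_closure
  have hOc : (Oᶜ).Nonempty := by
    obtain ⟨z, hz⟩ : (D.carrierᶜ).Nonempty := nonempty_compl.2 D.carrier_ne_univ
    exact ⟨z, fun hzO => hz hzO.1⟩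
  set K : ℕ → Set ℂ := fun k => {z | 1 / ((k : ℝ) + 1) ≤ infDist z Oᶜ} with hK
  have hKO : ∀ k, K k ⊆ O := fun k z hz => by
    by_contra hzO
    have hd : infDist z Oᶜ = 0 := infDist_zero_of_mem hzO
    have hpos : (0 : ℝ) < 1 / ((k : ℝ) + 1) := by positivity
    have hz' : 1 / ((k : ℝ) + 1) ≤ infDist z Oᶜ := hz
    linarith
  have hKc : ∀ k, IsCompact (K k) := fun k =>
    Metric.isCompact_of_isClosed_isBounded (isClosed_le continuous_const (continuous_infDist_pt _))
      (D.isBounded.subset ((hKO k).trans Set.sdiff_subset))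
  have hKint : ∀ z ∈ O, ∃ k₀ : ℕ, ∀ k, k₀ ≤ k → z ∈ interior (K k) := by
    intro z hz
    have hd : 0 < infDist z Oᶜ :=
      (hOo.isClosed_compl.notMem_iff_infDist_pos hOc).1 fun h => h hz
    obtain ⟨k₀, hk₀⟩ := exists_nat_one_div_lt hd
    refine ⟨k₀, fun k hk => ?_⟩
    have hsub : {w : ℂ | 1 / ((k : ℝ) + 1) < infDist w Oᶜ} ⊆ K k := fun w hw =>
      show 1 / ((k : ℝ) + 1) ≤ infDist w Oᶜ from le_of_lt hw
    apply interior_mono hsub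
    rw [(isOpen_lt continuous_const (continuous_infDist_pt _)).interior_eq]
    show 1 / ((k : ℝ) + 1) < infDist z Oᶜ
    have hk' : (k₀ : ℝ) + 1 ≤ (k : ℝ) + 1 := by exact_mod_cast Nat.add_le_add_right hk 1
    calc 1 / ((k : ℝ) + 1) ≤ 1 / ((k₀ : ℝ) + 1) := one_div_le_one_div_of_le (by positivity) hk'
      _ < infDist z Oᶜ := hk₀
  -- the carved super-domains
  have hsup : ∀ k, ∃ (E : DobrushinDomain) (T : Set ℂ), IsClosed T ∧
      Disjoint T (closure D'.carrier) ∧ E.carrier = D.carrier \ T ∧ E.pt 0 = D.pt 0 ∧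
      E.pt 1 = D.pt 1 ∧ Disjoint E.carrier (K k) := fun k =>
    AvoidancePassage.exists_superdomain D D' hD'sub h0 h1 (hKc k)
      ((hKO k).trans Set.sdiff_subset) (Set.disjoint_left.2 fun z hz hzc => (hKO k hz).2 hzc)
  choose E T hTcl hTD' hEcar hE0 hE1 hEK using hsup
  have hptcl : ∀ i, D.pt i ∈ closure D'.carrier := by
    intro i
    fin_cases i
    · exact frontier_subset_closure (h0 ▸ D'.pt_mem_frontier 0)
    · exact frontier_subset_closure (h1 ▸ D'.pt_mem_frontier 1)
  have hptT : ∀ k i, D.pt i ∉ T k := fun k i h => Set.disjoint_left.1 (hTD' k) h (hptcl i)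
  set Fk : ℕ → Set (CurveClass ℂ) := fun k => CurveClass.rangeSubset (closure (E k).carrier)
    with hFk
  have hFkm : ∀ k, MeasurableSet (Fk k) := fun k =>
    CurveClass.measurableSet_rangeSubset isClosed_closure
  have hadm : ∀ k, Tendsto (fun n => P n (Fk k)) atTop (𝓝 (μ (Fk k))) := fun k =>
    hconv (E k) (by rw [hEcar k]; exact Set.sdiff_subset) (hE0 k) (hE1 k)
      (AvoidancePassage.exists_ball_inter_eq D (E k) (hTcl k) (hEcar k) (hptT k 0) (hptT k 1))
  -- `ν F ≤ μ F_k` for every `k`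
  have hνle : ∀ k, ν F ≤ μ (Fk k) := by
    intro k
    set G : Set (CurveClass ℂ) := CurveClass.rangeSubset (T k)ᶜ with hG
    have hGo : IsOpen G := CurveClass.isOpen_rangeSubset (hTcl k).isOpen_compl
    have hFG : F ⊆ G := fun γ hγ => (show γ.range ⊆ closure D'.carrier from hγ).trans
      fun z hz hzT => Set.disjoint_left.1 (hTD' k) hzT hz
    have hGS : G ∩ S ⊆ Fk k := by
      rintro γ ⟨hγG, hγS⟩
      show γ.range ⊆ closure (E k).carrier
      rw [hEcar k]
      intro z hz
      have h' : z ∈ closure D.carrier ∩ (T k)ᶜ := ⟨hγS hz, hγG hz⟩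
      exact (hTcl k).isOpen_compl.closure_inter h'
    calc ν F ≤ ν G := measure_mono hFG
      _ ≤ liminf (fun n => P n G) atTop := hopen G hGo
      _ ≤ liminf (fun n => P n (Fk k) + P n Sᶜ) atTop := by
          refine liminf_le_liminf (Eventually.of_forall fun n => ?_)
          calc P n G ≤ P n (G ∩ S ∪ Sᶜ) := measure_mono fun γ hγ => by
                  by_cases h : γ ∈ S
                  · exact Or.inl ⟨hγ, h⟩
                  · exact Or.inr h
            _ ≤ P n (G ∩ S) + P n Sᶜ := measure_union_le _ _
            _ ≤ P n (Fk k) + P n Sᶜ := add_le_add (measure_mono hGS) le_rfl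
      _ = μ (Fk k) := by
          have := (hadm k).add hlimSc
          rw [add_zero] at this
          exact this.liminf_eq
  -- `μ F_k → μ F`: the limsup of the differences is `μ`-null
  set A : ℕ → Set (CurveClass ℂ) := fun k => ⋃ j, ⋃ (_ : k ≤ j), (Fk j \ F) with hA
  have hAm : ∀ k, MeasurableSet (A k) := fun k =>
    MeasurableSet.iUnion fun j => MeasurableSet.iUnion fun _ => (hFkm j).diff hFm
  have hAanti : Antitone A := fun j k hjk => iUnion₂_subset fun i hi =>
    subset_iUnion₂ (s := fun i (_ : j ≤ i) => Fk i \ F) i (hjk.trans hi)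
  have hAnull : μ (⋂ k, A k) = 0 := by
    refine measure_mono_null ?_ (ae_iff.1 hae)
    intro γ hγ hgood
    obtain ⟨hγD, hγfr⟩ := hgood
    obtain ⟨j₀, -, hγj₀⟩ := mem_iUnion₂.1 (mem_iInter.1 hγ 0)
    have hγF : γ ∉ F := hγj₀.2
    obtain ⟨z, hz, hzD'⟩ : ∃ z ∈ γ.range, z ∉ closure D'.carrier := by
      by_contra h
      push Not at h
      exact hγF h
    have hzD : z ∈ D.carrier := by
      have hzcl := hγD hz
      rw [closure_eq_self_union_frontier] at hzcl
      rcases hzcl with h | h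
      · exact h
      · exfalso
        have hmem : z ∈ ({D.pt 0, D.pt 1} : Set ℂ) := hγfr ⟨hz, h⟩
        rcases hmem with h' | h'
        · exact hzD' (h' ▸ hptcl 0)
        · exact hzD' (h' ▸ hptcl 1)
    obtain ⟨k₀, hk₀⟩ := hKint z ⟨hzD, hzD'⟩
    obtain ⟨j, hj, hγj⟩ := mem_iUnion₂.1 (mem_iInter.1 hγ k₀)
    have hzint : z ∈ interior (K j) := hk₀ j hj
    have hzE : z ∈ closure (E j).carrier := hγj.1 hz
    have hdis : Disjoint (closure (E j).carrier) (interior (K j)) :=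
      ((hEK j).mono_right interior_subset).closure_left isOpen_interior
    exact Set.disjoint_left.1 hdis hzE hzint
  have hAlim : Tendsto (fun k => μ (A k)) atTop (𝓝 0) := by
    have := tendsto_measure_iInter_atTop (μ := μ) (fun k => (hAm k).nullMeasurableSet) hAanti
      ⟨0, measure_ne_top μ _⟩
    rw [hAnull] at this
    exact this
  have hle : ν F ≤ μ F := by
    have hbound : ∀ k, ν F ≤ μ F + μ (A k) := fun k =>
      calc ν F ≤ μ (Fk k) := hνle k
        _ ≤ μ (F ∪ A k) := measure_mono fun γ hγ => by
            by_cases h : γ ∈ F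
            · exact Or.inl h
            · exact Or.inr (mem_iUnion₂.2 ⟨k, le_rfl, hγ, h⟩)
        _ ≤ μ F + μ (A k) := measure_union_le _ _
    have hT : Tendsto (fun k => μ F + μ (A k)) atTop (𝓝 (μ F + 0)) :=
      tendsto_const_nhds.add hAlim
    rw [add_zero] at hT
    exact ge_of_tendsto' hT hbound
  exact le_antisymm hle hge

/-! ### The registered stub -/

/-- **I3 — the portmanteau sandwich for GM's `π/2` walk** (registered stub
`stub_ybAvoidancePassage` of the skeleton of crux `CompassSLE`, verbatim): if `ν` is the weak limit
of the pushed-forward laws `ybLaw (fun _ => π/2) D.carrier (s n) 1 (a (s n)) (b (s n))` along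
`s_n → 0⁺`, `μ` an SLE(8/3) law of `D`, and along `s_n` the lattice avoidance probabilities of EVERY
hull subdomain `D''` converge to `μ(range ⊆ closure D'')`, then
`ν(range ⊆ closure D') = μ(range ⊆ closure D')` for every hull subdomain `D'`. The abstract
sandwich `avoidancePassage_of_mass_zero_or_one` for the pushed-forward laws (measurable push-forward
on the discrete σ-algebra, `YBWalk.measurable_of_top`; masses `0` or `1`,
`ybLaw_univ_eq_zero_or_one`; weak convergence transferred by `integral_map`). [folklore] -/
theorem stub_ybAvoidancePassage :
    ∀ (D : DobrushinDomain) (a b : ℝ → MidEdge),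
      IsYBEndpointApprox (fun (_ : ℤ) => Real.pi / 2) D a b →
      ∀ (s : ℕ → ℝ) (ν μ : Measure (CurveClass ℂ)), Tendsto s atTop (𝓝[>] (0 : ℝ)) →
        IsProbabilityMeasure ν →
        (∀ f : BoundedContinuousFunction (CurveClass ℂ) ℝ,
          Tendsto (fun n => ∫ γ, f (γ.curve (fun (_ : ℤ) => Real.pi / 2) (s n))
              ∂(ybLaw (fun (_ : ℤ) => Real.pi / 2) D.carrier (s n) 1 (a (s n)) (b (s n))))
            atTop (𝓝 (∫ x, f x ∂ν))) →
        IsSLELaw ((8 : NNReal) / 3) D μ →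
        (∀ D' : DobrushinDomain, D'.carrier ⊆ D.carrier → D'.pt 0 = D.pt 0 → D'.pt 1 = D.pt 1 →
          (∃ ε : ℝ, 0 < ε ∧ D'.carrier ∩ Metric.ball (D.pt 0) ε = D.carrier ∩ Metric.ball (D.pt 0) ε ∧
            D'.carrier ∩ Metric.ball (D.pt 1) ε = D.carrier ∩ Metric.ball (D.pt 1) ε) →
          Tendsto (fun n => ((ybLaw (fun (_ : ℤ) => Real.pi / 2) D.carrier (s n) 1 (a (s n)) (b (s n))).map
              (fun γ => γ.curve (fun (_ : ℤ) => Real.pi / 2) (s n)))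
              (CurveClass.rangeSubset (closure D'.carrier)))
            atTop (𝓝 (μ (CurveClass.rangeSubset (closure D'.carrier))))) →
        ∀ D' : DobrushinDomain, D'.carrier ⊆ D.carrier → D'.pt 0 = D.pt 0 → D'.pt 1 = D.pt 1 →
          (∃ ε : ℝ, 0 < ε ∧ D'.carrier ∩ Metric.ball (D.pt 0) ε = D.carrier ∩ Metric.ball (D.pt 0) ε ∧
            D'.carrier ∩ Metric.ball (D.pt 1) ε = D.carrier ∩ Metric.ball (D.pt 1) ε) →
          ν (CurveClass.rangeSubset (closure D'.carrier)) =
            μ (CurveClass.rangeSubset (closure D'.carrier)) := by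
  intro D a b _ s ν μ _ hν hweak hμ hconv D' hD'sub h0 h1 hεD'
  -- the push-forward along the drawing map is measurable (discrete σ-algebra on the walks)
  have hmeas : ∀ n, Measurable
      (fun γ : YangBaxterSAW (fun (_ : ℤ) => Real.pi / 2) D.carrier (s n) (a (s n)) (b (s n)) =>
        γ.curve (fun (_ : ℤ) => Real.pi / 2) (s n)) := fun n =>
    YBWalk.measurable_of_top _
  refine avoidancePassage_of_mass_zero_or_one D
    (fun n => (ybLaw (fun (_ : ℤ) => Real.pi / 2) D.carrier (s n) 1 (a (s n)) (b (s n))).map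
      (fun γ => γ.curve (fun (_ : ℤ) => Real.pi / 2) (s n)))
    ν μ hν (fun n => ?_) (fun f => ?_) hμ hconv D' hD'sub h0 h1 hεD'
  · -- masses `0` or `1`
    rw [Measure.map_apply (hmeas n) MeasurableSet.univ, preimage_univ]
    exact ybLaw_univ_eq_zero_or_one _ _ _ _ _ _
  · -- weak convergence of the pushed-forward laws
    have hint : ∀ n,
        ∫ x, f x ∂((ybLaw (fun (_ : ℤ) => Real.pi / 2) D.carrier (s n) 1 (a (s n)) (b (s n))).map
          (fun γ => γ.curve (fun (_ : ℤ) => Real.pi / 2) (s n))) =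
        ∫ γ, f (γ.curve (fun (_ : ℤ) => Real.pi / 2) (s n))
          ∂(ybLaw (fun (_ : ℤ) => Real.pi / 2) D.carrier (s n) 1 (a (s n)) (b (s n))) := fun n =>
      integral_map (hmeas n).aemeasurable f.continuous.aestronglyMeasurable
    simp only [hint]
    exact hweak f

end Summit.CriticalPhenomena.SAWScalingLimit.Theorems.SAWCompassLatticeCompassSLE

end
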